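import Literature.NumberTheory.PAdicHodge.BmaxPlusFormalLogDivisionTower
import Literature.NumberTheory.PAdicHodge.BmaxPlusToBdRPeriods
import Literature.NumberTheory.PAdicHodge.BmaxPlusFormalLogThetaFrobenius
import Literature.NumberTheory.PAdicHodge.AinfFrobeniusDivisionLift
import Literature.NumberTheory.PAdicHodge.AinfWeierstrassSupersingularSmallPoints
import HarnessLib

/-!
# Level descent of the `A_max`-periods in `B_dR⁺`: `f(Λ_N(ι[ũ])) = p^{N+n}·L₁`, `f(φΛ_N(ι[ũ])) = p^{N+n}·L₂` with `L₁, L₂` `p`-adic values of `log_W` at the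
# SHALLOW level-`n` points `[ũ⁽ⁿ⁾]`, `φ[ũ⁽ⁿ⁾]`

Topic `Literature/NumberTheory/PAdicHodge`; namespace `Literature.NumberTheory.PAdicHodge.AinfTop`. THEOREMS ONLY (no definition, no named fact, no instance, no
`sorry`). Assembly of tree facts on Colmez's `A_max`-periods `Λ_N(ι[ũ], z) = p^N·log_W(ι[ũ])` of an exact `[p]_W`-division tower `u` of `Ŵ(𝔪_ℂ)` (`W/ℤ`):
`[p]`-compatibility `Λ_N(ι[ũ⁽ᵐ⁾]) = p·Λ_N(ι[ũ⁽ᵐ⁺¹⁾])` (`logSum_divisionLiftPt_eq_natCast_mul_logSum_shift`), index change (`PadicLogSeries.logSum_eq_pow_mul_logSum`),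
honest `B_dR⁺`-values at any depth (`exists_forall_isLogTypeModFil_bmaxPlusToBdR_logSum`) and the naturality of `φ` (`frobBmaxPlus_logSum_algebraMap`):
* `exists_index_ge` — a common nilpotence index `N′ ≥ N` for the first `n + 1` levels (`‖uₘ‖ ≤ ‖uₙ‖` for `m ≤ n`, `‖uₙ‖ < 1`);
* ★ `logSum_eq_pow_mul_logSum_level` — `Λ_{N′}(ι[ũ], z₀) = pⁿ·Λ_{N′}(ι[ũ⁽ⁿ⁾], zₙ)` in `A_max` (iteration of the `[p]`-compatibility);
* ★★ `exists_bmaxPlusToBdR_logSum_eq_pow_mul_value_level` — **`f(Λ_N(ι[ũ], z)) = p^{N+n}·L₁` with `IsLogTypeModFil (formalLogNum W p) k [ũ⁽ⁿ⁾] L₁` for every `k`**,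
  and **`f(φΛ_N(ι[ũ], z)) = p^{N+n}·L₂` with `IsLogTypeModFil (formalLogNum W p) k (φ[ũ⁽ⁿ⁾]) L₂`** (the exponent `N′` cancels).
So the crystalline periods of a tower — e.g. the transported periods `P⁰τ = f(LT τ)`, `Q⁰τ = f(φ LT τ)` of the K★ cells — are `p^{N+n}` times `p`-adic values of
`log_W` at the shallow level-`n` lifts, whose θ-values `uₙ`, `≡ uₙᵖ (mod p)` are known (`norm_theta_frob_sub_pow_le`). Purpose: the E₀-side of the
Hodge-line identity (crux K★ `stmt-BirchSwinnertonDyer-22226`, line `kato_lever`, memo `Lines/kato-lever-K2-hne-direct-omega.md` §1, F3a). Infrastructure only: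
BSD / K★ are not proved by any of this.

## References
* P. Colmez, *Périodes p-adiques des variétés abéliennes*, Math. Ann. 292 (1992), §2. [Colmez1992PeriodesAbeliennes]
* J.-M. Fontaine, *Le corps des périodes p-adiques*, Astérisque 223 (1994), Exp. II §1.5, Exp. III §5. [FontaineAsterisque223III]
* J.-M. Fontaine, *Formes différentielles et modules de Tate…*, Invent. Math. 65 (1982), §5. [Fontaine1982FormesDifferentielles]
-/

noncomputable section

open Ideal WittVector ValuativeRel Field

namespace Literature.NumberTheory.PAdicHodge

namespace AinfTop

open Literature.NumberTheory.GaloisRepresentations Literature.NumberTheory.GaloisRepresentations.IsNonarchimedeanLocalField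
open Literature.NumberTheory.GaloisRepresentations.LubinTate Literature.RingTheory.FormalGroups GaloisContinuity

variable {F : Type} [Field F] [ValuativeRel F] [TopologicalSpace F] [IsNonarchimedeanLocalField F]
  [CharZero F] {p : ℕ} [Fact p.Prime] [Fact (¬ IsUnit (p : integerC F))]
  [IsAdicComplete (Ideal.span {(p : integerC F)}) (integerC F)]
  {hθ : Function.Surjective (fontaineTheta (integerC F) p)} (W : WeierstrassCurve ℤ)

/-! ## §1 A common nilpotence index for the first levels -/

omit [CharZero F] [Fact p.Prime] [Fact (¬ IsUnit (p : integerC F))] [IsAdicComplete (Ideal.span {(p : integerC F)}) (integerC F)] in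
/-- `‖uₘ‖ ≤ ‖u_{m+j}‖`: the members of a `[p]`-division tower do not decrease in norm (`‖[p]x‖ ≤ ‖x‖`). [cite: SilvermanAEC2009, IV.2.3] -/
theorem norm_seq_le_norm_seq_add {u : ℕ → (maxNilIdealC F).toIdeal} (hup : ∀ n, mulPC F p W (u (n + 1)) = u n) (m j : ℕ) :
    ‖(((u m : (maxNilIdealC F).toIdeal) : CBall F) : CompletedAlgClosure F)‖ ≤
      ‖(((u (m + j) : (maxNilIdealC F).toIdeal) : CBall F) : CompletedAlgClosure F)‖ := by
  induction j with
  | zero => exact le_rfl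
  | succ j ih =>
    refine ih.trans ?_
    rw [← hup (m + j), ← Nat.add_assoc]
    exact norm_mulPC_le W (u (m + j + 1))

omit [Fact (¬ IsUnit (p : integerC F))] [IsAdicComplete (Ideal.span {(p : integerC F)}) (integerC F)] in
/-- ★ **A common index**: for every level `n` and every `N` there is `N′ ≥ N`, `N′ ≥ 1`, with `‖uₘ‖^{N′} ≤ ‖p‖` for ALL `m ≤ n`.
[cite: Colmez1992PeriodesAbeliennes, §2] -/
theorem exists_index_ge {u : ℕ → (maxNilIdealC F).toIdeal} (hup : ∀ n, mulPC F p W (u (n + 1)) = u n) (n N : ℕ) :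
    ∃ N' : ℕ, N ≤ N' ∧ 1 ≤ N' ∧ ∀ m, m ≤ n →
      ‖(((u m : (maxNilIdealC F).toIdeal) : CBall F) : CompletedAlgClosure F)‖ ^ N' ≤ ‖(p : CompletedAlgClosure F)‖ := by
  have hlt : ‖(((u n : (maxNilIdealC F).toIdeal) : CBall F) : CompletedAlgClosure F)‖ < 1 := (u n).2
  have hp0 : 0 < ‖(p : CompletedAlgClosure F)‖ := norm_pos_iff.2 (natCast_C_ne_zero (F := F) (Fact.out : p.Prime).ne_zero)
  obtain ⟨M, hM⟩ := exists_pow_lt_of_lt_one hp0 hlt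
  refine ⟨M + N + 1, by omega, by omega, fun m hm => ?_⟩
  have h1 : ‖(((u m : (maxNilIdealC F).toIdeal) : CBall F) : CompletedAlgClosure F)‖ ≤
      ‖(((u n : (maxNilIdealC F).toIdeal) : CBall F) : CompletedAlgClosure F)‖ := by
    obtain ⟨j, rfl⟩ := Nat.exists_eq_add_of_le hm
    exact norm_seq_le_norm_seq_add W hup m j
  calc ‖(((u m : (maxNilIdealC F).toIdeal) : CBall F) : CompletedAlgClosure F)‖ ^ (M + N + 1)
      ≤ ‖(((u n : (maxNilIdealC F).toIdeal) : CBall F) : CompletedAlgClosure F)‖ ^ (M + N + 1) :=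
        pow_le_pow_left₀ (norm_nonneg _) h1 _
    _ ≤ ‖(((u n : (maxNilIdealC F).toIdeal) : CBall F) : CompletedAlgClosure F)‖ ^ M := by
        refine pow_le_pow_of_le_one (norm_nonneg _) hlt.le (by omega)
    _ ≤ ‖(p : CompletedAlgClosure F)‖ := hM.le

set_option maxHeartbeats 1600000 in
/-- A witness `ι[ũ⁽ᵐ⁾]^{N′} = p·z` at every level `m ≤ n` for a common index. [cite: Colmez1992PeriodesAbeliennes, §2] -/
theorem exists_witness_level {u : ℕ → (maxNilIdealC F).toIdeal} (hup : ∀ n, mulPC F p W (u (n + 1)) = u n) {N' : ℕ} (m : ℕ)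
    (hm : ‖(((u m : (maxNilIdealC F).toIdeal) : CBall F) : CompletedAlgClosure F)‖ ^ N' ≤ ‖(p : CompletedAlgClosure F)‖) :
    ∃ z : bmaxZero F p, algebraMap (Ainf (p := p) F) (bmaxZero F p) ((AinfTop.of F p).symm
        (((divisionLiftPt W hθ (fun i => u (m + i)) (mulPC_shift W hup m)).val : (nilTheta F p hθ).toIdeal) : AinfTop F p)) ^ N' =
      (p : bmaxZero F p) * z := by
  have h := pow_coe_val_nsmul_divisionLiftPt_mem W (hθ := hθ) (u := fun i => u (m + i)) (mulPC_shift W hup m) (N := N')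
    (by simpa using hm) 1
  rw [one_nsmul] at h
  exact exists_algebraMap_pow_eq_natCast_mul h

/-! ## §2 Iterated `[p]`-compatibility: `Λ_{N′}(ι[ũ]) = pⁿ·Λ_{N′}(ι[ũ⁽ⁿ⁾])` -/

set_option maxHeartbeats 3200000 in
/-- ★ **`Λ_{N′}(ι[ũ⁽⁰⁾], z₀) = pⁿ·Λ_{N′}(ι[ũ⁽ⁿ⁾], zₙ)`** for a common index `N′` of the levels `≤ n` and ANY witnesses (iteration of
`logSum_divisionLiftPt_eq_natCast_mul_logSum_shift`). [cite: Colmez1992PeriodesAbeliennes, §2] [cite: FontaineAsterisque223III, Exp. III §5] -/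
theorem logSum_eq_pow_mul_logSum_level {u : ℕ → (maxNilIdealC F).toIdeal} (hup : ∀ n, mulPC F p W (u (n + 1)) = u n) {N' : ℕ} (hN' : 1 ≤ N')
    (n : ℕ) (hun : ∀ m, m ≤ n → ‖(((u m : (maxNilIdealC F).toIdeal) : CBall F) : CompletedAlgClosure F)‖ ^ N' ≤ ‖(p : CompletedAlgClosure F)‖)
    {z₀ zn : bmaxZero F p}
    (hz₀ : algebraMap (Ainf (p := p) F) (bmaxZero F p) ((AinfTop.of F p).symm
        (((divisionLiftPt W hθ (fun i => u (0 + i)) (mulPC_shift W hup 0)).val : (nilTheta F p hθ).toIdeal) : AinfTop F p)) ^ N' =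
      (p : bmaxZero F p) * z₀)
    (hzn : algebraMap (Ainf (p := p) F) (bmaxZero F p) ((AinfTop.of F p).symm
        (((divisionLiftPt W hθ (fun i => u (n + i)) (mulPC_shift W hup n)).val : (nilTheta F p hθ).toIdeal) : AinfTop F p)) ^ N' =
      (p : bmaxZero F p) * zn) :
    PadicLogSeries.logSum ((algebraMap (Ainf (p := p) F) (bmaxZero F p)).comp zpToAinf) (GaloisContinuity.formalLogNum W p) N'
        (algebraMap (Ainf (p := p) F) (bmaxZero F p) ((AinfTop.of F p).symm
          (((divisionLiftPt W hθ (fun i => u (0 + i)) (mulPC_shift W hup 0)).val : (nilTheta F p hθ).toIdeal) : AinfTop F p))) z₀ =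
      (p : BmaxPlus F p) ^ n *
        PadicLogSeries.logSum ((algebraMap (Ainf (p := p) F) (bmaxZero F p)).comp zpToAinf) (GaloisContinuity.formalLogNum W p) N'
          (algebraMap (Ainf (p := p) F) (bmaxZero F p) ((AinfTop.of F p).symm
            (((divisionLiftPt W hθ (fun i => u (n + i)) (mulPC_shift W hup n)).val : (nilTheta F p hθ).toIdeal) : AinfTop F p))) zn := by
  induction n generalizing zn with
  | zero =>
    haveI := isDomain_bmaxZero (F := F) (p := p)
    haveI := charZero_bmaxZero (F := F) (p := p)
    rw [pow_zero, one_mul, PadicLogSeries.logSum_congr_witness _ _ hz₀ hzn]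
  | succ n ih =>
    obtain ⟨zn', hzn'⟩ := exists_witness_level W (hθ := hθ) hup n (hun n (Nat.le_succ n))
    rw [ih (fun m hm => hun m (hm.trans (Nat.le_succ n))) hzn', pow_succ, mul_assoc,
      logSum_divisionLiftPt_eq_natCast_mul_logSum_shift W hup n hN' (hun (n + 1) le_rfl) hzn' hzn]

/-! ## §3 The values at level `n` -/

set_option maxHeartbeats 3200000 in
/-- ★★ **Level descent of `f(Λ_N)` and `f(φΛ_N)`.** For an exact `[p]_W`-division tower `u` (`W/ℤ`), an index `N ≥ 1` with witness `ι[ũ]^N = p·z`, and ANY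
level `n`: there are `L₁, L₂ ∈ B_dR⁺` with **`f(Λ_N(ι[ũ], z)) = p^{N+n}·L₁`**, **`f(φ(Λ_N(ι[ũ], z))) = p^{N+n}·L₂`**, `L₁` a `p`-adic value of `log_W` at the level-`n`
lift `[ũ⁽ⁿ⁾]` and `L₂` one at `φ[ũ⁽ⁿ⁾]`, modulo EVERY `Fil^k` (`IsLogTypeModFil (formalLogNum W p) k · ·`). The level-`n` points are shallow (`θ[ũ⁽ⁿ⁾] = uₙ`,
`θ(φ[ũ⁽ⁿ⁾]) ≡ uₙᵖ (mod p)`). [cite: Colmez1992PeriodesAbeliennes, §2] [cite: FontaineAsterisque223III, Exp. III §5] [cite: Fontaine1982FormesDifferentielles, §5] -/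
theorem exists_bmaxPlusToBdR_logSum_eq_pow_mul_value_level {u : ℕ → (maxNilIdealC F).toIdeal} (hup : ∀ n, mulPC F p W (u (n + 1)) = u n)
    {N : ℕ} (hN : 1 ≤ N) {z : bmaxZero F p}
    (hz : algebraMap (Ainf (p := p) F) (bmaxZero F p) ((AinfTop.of F p).symm
        (((divisionLiftPt W hθ u hup).val : (nilTheta F p hθ).toIdeal) : AinfTop F p)) ^ N = (p : bmaxZero F p) * z) (n : ℕ) :
    ∃ L₁ L₂ : BDeRhamPlus (integerC F) p,
      bmaxPlusToBdR F p (PadicLogSeries.logSum ((algebraMap (Ainf (p := p) F) (bmaxZero F p)).comp zpToAinf) (GaloisContinuity.formalLogNum W p) N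
          (algebraMap (Ainf (p := p) F) (bmaxZero F p) ((AinfTop.of F p).symm
            (((divisionLiftPt W hθ u hup).val : (nilTheta F p hθ).toIdeal) : AinfTop F p))) z) =
        (p : BDeRhamPlus (integerC F) p) ^ (N + n) * L₁ ∧
      bmaxPlusToBdR F p (frobBmaxPlus F p (PadicLogSeries.logSum ((algebraMap (Ainf (p := p) F) (bmaxZero F p)).comp zpToAinf)
          (GaloisContinuity.formalLogNum W p) N
          (algebraMap (Ainf (p := p) F) (bmaxZero F p) ((AinfTop.of F p).symm
            (((divisionLiftPt W hθ u hup).val : (nilTheta F p hθ).toIdeal) : AinfTop F p))) z)) =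
        (p : BDeRhamPlus (integerC F) p) ^ (N + n) * L₂ ∧
      (∀ k : ℕ, IsLogTypeModFil (GaloisContinuity.formalLogNum W p) k
        ((AinfTop.of F p).symm (((divisionLiftPt W hθ (fun i => u (n + i)) (mulPC_shift W hup n)).val : (nilTheta F p hθ).toIdeal) : AinfTop F p)) L₁) ∧
      (∀ k : ℕ, IsLogTypeModFil (GaloisContinuity.formalLogNum W p) k
        (WittVector.frobenius ((AinfTop.of F p).symm
          (((divisionLiftPt W hθ (fun i => u (n + i)) (mulPC_shift W hup n)).val : (nilTheta F p hθ).toIdeal) : AinfTop F p))) L₂) := by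
  haveI := isDomain_bmaxZero (F := F) (p := p)
  haveI := charZero_bmaxZero (F := F) (p := p)
  set ι := (algebraMap (Ainf (p := p) F) (bmaxZero F p)).comp zpToAinf with hι
  set b := GaloisContinuity.formalLogNum W p with hb
  -- a common index `N' ≥ N` for the levels `≤ n`, witnesses at levels `0` and `n`
  obtain ⟨N', hNN', hN'1, hun⟩ := exists_index_ge W hup n N
  obtain ⟨z₀, hz₀⟩ := exists_witness_level W (hθ := hθ) hup 0 (hun 0 (Nat.zero_le n))
  obtain ⟨zn, hzn⟩ := exists_witness_level W (hθ := hθ) hup n (hun n le_rfl)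
  -- level `0` in the shifted form is the original tower
  have h00 : divisionLiftPt W hθ (fun i => u (0 + i)) (mulPC_shift W hup 0) = divisionLiftPt W hθ u hup :=
    divisionLiftPt_congr W (funext fun i => by rw [Nat.zero_add]) _ hup
  rw [h00] at hz₀
  set y0 := algebraMap (Ainf (p := p) F) (bmaxZero F p) ((AinfTop.of F p).symm
    (((divisionLiftPt W hθ u hup).val : (nilTheta F p hθ).toIdeal) : AinfTop F p)) with hy0
  set yn := (AinfTop.of F p).symm
    (((divisionLiftPt W hθ (fun i => u (n + i)) (mulPC_shift W hup n)).val : (nilTheta F p hθ).toIdeal) : AinfTop F p) with hyn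
  -- index change at level 0 and the iterated `[p]`-compatibility
  have hidx : PadicLogSeries.logSum ι b N' y0 z₀ =
      AdicCompletion.of (Ideal.span {(p : bmaxZero F p)}) (bmaxZero F p) ((p : bmaxZero F p) ^ (N' - N)) * PadicLogSeries.logSum ι b N y0 z :=
    PadicLogSeries.logSum_eq_pow_mul_logSum ι b hN hNN' hz hz₀
  have hlev := logSum_eq_pow_mul_logSum_level W (hθ := hθ) hup hN'1 n hun (z₀ := z₀) (zn := zn) (by rw [h00]; exact hz₀) hzn
  rw [h00] at hlev
  -- honest values at level `n` (any depth) and at its Frobenius image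
  obtain ⟨L₁, hL₁, hL₁'⟩ := exists_forall_isLogTypeModFil_bmaxPlusToBdR_logSum b hN'1 yn hzn
  have hznφ : algebraMap (Ainf (p := p) F) (bmaxZero F p) (WittVector.frobenius yn) ^ N' = (p : bmaxZero F p) * frobBmaxZero F p zn := by
    have h := congrArg (frobBmaxZero F p) hzn
    rwa [map_pow, map_mul, map_natCast, frobBmaxZero_algebraMap] at h
  obtain ⟨L₂, hL₂, hL₂'⟩ := exists_forall_isLogTypeModFil_bmaxPlusToBdR_logSum b hN'1 (WittVector.frobenius yn) hznφ
  have hofp : AdicCompletion.of (Ideal.span {(p : bmaxZero F p)}) (bmaxZero F p) ((p : bmaxZero F p) ^ (N' - N)) = (p : BmaxPlus F p) ^ (N' - N) := by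
    change algebraMap (bmaxZero F p) (BmaxPlus F p) ((p : bmaxZero F p) ^ (N' - N)) = _
    rw [map_pow, map_natCast]
  -- `p^{N'-N}·f(Λ_N) = f(Λ_{N'}(lvl 0)) = pⁿ f(Λ_{N'}(lvl n)) = pⁿ p^{N'} L₁`
  have hu : IsUnit ((p : BDeRhamPlus (integerC F) p) ^ (N' - N)) := (isUnit_natCast_bDeRhamPlus (F := F) (p := p) (Fact.out : p.Prime).ne_zero).pow _
  have key1 : (p : BDeRhamPlus (integerC F) p) ^ (N' - N) * bmaxPlusToBdR F p (PadicLogSeries.logSum ι b N y0 z) =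
      (p : BDeRhamPlus (integerC F) p) ^ (N' - N) * ((p : BDeRhamPlus (integerC F) p) ^ (N + n) * L₁) := by
    have h := congrArg (bmaxPlusToBdR F p) hidx
    rw [hofp, map_mul, map_pow, map_natCast, hlev, map_mul, map_pow, map_natCast, ← hL₁] at h
    rw [← h]
    have e : N' + n = (N' - N) + (N + n) := by omega
    rw [show (p : BDeRhamPlus (integerC F) p) ^ n * ((p : BDeRhamPlus (integerC F) p) ^ N' * L₁) = (p : BDeRhamPlus (integerC F) p) ^ (N' + n) * L₁ by ring,
      e, pow_add]
    ring
  have eφ : frobBmaxPlus F p (PadicLogSeries.logSum ι b N' y0 z₀) =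
      (p : BmaxPlus F p) ^ n * PadicLogSeries.logSum ι b N' (algebraMap (Ainf (p := p) F) (bmaxZero F p) (WittVector.frobenius yn)) (frobBmaxZero F p zn) := by
    rw [hlev, map_mul, map_pow, map_natCast]
    congr 1
    exact frobBmaxPlus_logSum_algebraMap b N' yn zn
  have eφ' : frobBmaxPlus F p (PadicLogSeries.logSum ι b N' y0 z₀) =
      (p : BmaxPlus F p) ^ (N' - N) * frobBmaxPlus F p (PadicLogSeries.logSum ι b N y0 z) := by
    rw [hidx, map_mul, hofp, map_pow, map_natCast]
  have key2 : (p : BDeRhamPlus (integerC F) p) ^ (N' - N) * bmaxPlusToBdR F p (frobBmaxPlus F p (PadicLogSeries.logSum ι b N y0 z)) =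
      (p : BDeRhamPlus (integerC F) p) ^ (N' - N) * ((p : BDeRhamPlus (integerC F) p) ^ (N + n) * L₂) := by
    have h1 : bmaxPlusToBdR F p (frobBmaxPlus F p (PadicLogSeries.logSum ι b N' y0 z₀)) =
        (p : BDeRhamPlus (integerC F) p) ^ (N' - N) * bmaxPlusToBdR F p (frobBmaxPlus F p (PadicLogSeries.logSum ι b N y0 z)) := by
      rw [eφ', map_mul, map_pow, map_natCast]
    have h2 : bmaxPlusToBdR F p (frobBmaxPlus F p (PadicLogSeries.logSum ι b N' y0 z₀)) =
        (p : BDeRhamPlus (integerC F) p) ^ n * ((p : BDeRhamPlus (integerC F) p) ^ N' * L₂) := by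
      rw [eφ, map_mul, map_pow, map_natCast, hL₂]
    rw [← h1, h2]
    have e : N' + n = (N' - N) + (N + n) := by omega
    rw [show (p : BDeRhamPlus (integerC F) p) ^ n * ((p : BDeRhamPlus (integerC F) p) ^ N' * L₂) = (p : BDeRhamPlus (integerC F) p) ^ (N' + n) * L₂ by ring,
      e, pow_add]
    ring
  exact ⟨L₁, L₂, hu.mul_left_cancel key1, hu.mul_left_cancel key2, hL₁', hL₂'⟩

end AinfTop

end Literature.NumberTheory.PAdicHodge

end
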